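import Summits.BirchSwinnertonDyer.BirchSwinnertonDyer.Theses.CyclotomicUntwist
import Literature.NumberTheory.EllipticCurves.ZywinaCMImageProofs
import HarnessLib

/-!
# Route `CyclotomicUntwist`: the `¬ CM` binder of the three cruxes is IDLE (a surjective `ρ̄_{E,3}` forbids CM)

Cell `pub/bsd-wall` (D-0145 line `route-BirchSwinnertonDyer-CyclotomicUntwist`), seat `bsd-line-cycu-p4` (width
seat 4, gen 4). Helper toward the cruxes K1 `PSRankOneLowerHalfAtThree` (stmt-BirchSwinnertonDyer-21580), K2
`PSRankOneUpperHalfAtThree` (stmt-21581) and the residual X3 `WildSurjRankOneSupercuspidalAtThree` (stmt-21582).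
THEOREMS ONLY (no definition, no named fact, no `sorry`); BSD is not proved by this file and no crux is.

Every row of the leaf `WAllExclAddWildRankOneSurj` carries `Surj W 3` (`ρ̄_{E,3}` onto `GL₂(𝔽₃)`), and the tree's
Literature THEOREM `WeierstrassCurve.not_hasSurjectiveModNGaloisRep_of_hasCM` (Zywina 2015, Prop. 1.14/1.16 after
Serre 1972 §4.5: a CM curve has no surjective mod-`ℓ` image at any odd `ℓ`) makes the binder `¬ W.HasCM` of the three
crux texts AUTOMATIC. Recorded BY NAME: each crux is equivalent to its `¬ CM`-free form (`…_iff_cmFree`), so a line /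
stub / retriage may drop the binder, and any consumer holding the `¬ CM`-free statement closes the crux verbatim
(`…_of_cmFree`). Companion facts already in the tree for the same rows: the `3`-adic tower binder is idle on the
principal-series rows (`PSTowerOfEven.towerSurj_three_of_addv_of_surj_of_even`, cycu-p4 g3) and `3 ∤ #E(ℚ)_tors`
(`Additive.not_dvd_torsionOrder_of_surj`).

References: D. Zywina, *On the possible images of the mod ℓ representations associated to elliptic curves over ℚ*
(2015), Prop. 1.14, 1.16 [Zywina2015]; J.-P. Serre, Invent. Math. 15 (1972), §4.5 [Serre1972].
-/

open scoped Classical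

open WeierstrassCurve Literature.NumberTheory.EllipticCurves Literature.NumberTheory.EllipticCurves.Rank1Residual
  Literature.NumberTheory.EllipticCurves.Rank1Residual.Typed Summit.BirchSwinnertonDyer.Rank1Residual.Additive
  Summit.BirchSwinnertonDyer.BirchSwinnertonDyer.Theses.CyclotomicUntwist

-- single-conjunct summit: `Summit.BirchSwinnertonDyer.BirchSwinnertonDyer.…` repeats the name by design
set_option linter.dupNamespace false
set_option autoImplicit false

namespace Summit.BirchSwinnertonDyer.BirchSwinnertonDyer.Theorems.PSIdleBinders

/-- **`ρ̄_{E,3}` onto ⟹ `E` has no CM** (Zywina 2015 Prop. 1.14/1.16, Serre 1972 §4.5; the tree's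
`not_hasSurjectiveModNGaloisRep_of_hasCM` at `ℓ = 3`). [cite: Zywina2015, Prop. 1.14 and Prop. 1.16 (§1.9)]
[cite: Serre1972, §4.5] -/
theorem not_hasCM_of_surj_three (W : WeierstrassCurve ℚ) [W.IsElliptic] (hsurj : Surj W 3) : ¬ W.HasCM :=
  fun hcm ↦ not_hasSurjectiveModNGaloisRep_of_hasCM W hcm Nat.prime_three (by norm_num) hsurj

/-- **K1 without the `¬ CM` binder is the same statement.** [cite: Zywina2015, Prop. 1.14 and Prop. 1.16 (§1.9)] -/
theorem psRankOneLowerHalfAtThree_iff_cmFree :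
    PSRankOneLowerHalfAtThree ↔
      ∀ (W : WeierstrassCurve ℚ) [W.IsElliptic] [W.IsGloballyMinimal],
        ClassO6 W 3 → Surj W 3 → Even (padicValInt 3 W.minimalDiscriminantInt) →
        W.minimalDiscriminantInt / 3 ^ padicValInt 3 W.minimalDiscriminantInt % 3 = 1 →
        W.analyticRank = 1 → MissingLowerBoundAt W 3 := by
  constructor
  · intro h W _ _ hO6 hsurj hev hsq hr
    exact h W (not_hasCM_of_surj_three W hsurj) hO6 hsurj hev hsq hr
  · intro h W _ _ _ hO6 hsurj hev hsq hr
    exact h W hO6 hsurj hev hsq hr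

/-- K1 BY NAME from its `¬ CM`-free form. [cite: Zywina2015, Prop. 1.14 and Prop. 1.16 (§1.9)] -/
theorem psRankOneLowerHalfAtThree_of_cmFree
    (h : ∀ (W : WeierstrassCurve ℚ) [W.IsElliptic] [W.IsGloballyMinimal],
      ClassO6 W 3 → Surj W 3 → Even (padicValInt 3 W.minimalDiscriminantInt) →
      W.minimalDiscriminantInt / 3 ^ padicValInt 3 W.minimalDiscriminantInt % 3 = 1 →
      W.analyticRank = 1 → MissingLowerBoundAt W 3) :
    PSRankOneLowerHalfAtThree :=
  psRankOneLowerHalfAtThree_iff_cmFree.mpr h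

/-- **K2 without the `¬ CM` binder is the same statement.** [cite: Zywina2015, Prop. 1.14 and Prop. 1.16 (§1.9)] -/
theorem psRankOneUpperHalfAtThree_iff_cmFree :
    PSRankOneUpperHalfAtThree ↔
      ∀ (W : WeierstrassCurve ℚ) [W.IsElliptic] [W.IsGloballyMinimal],
        ClassO6 W 3 → Surj W 3 → Even (padicValInt 3 W.minimalDiscriminantInt) →
        W.minimalDiscriminantInt / 3 ^ padicValInt 3 W.minimalDiscriminantInt % 3 = 1 →
        W.analyticRank = 1 → MissingUpperBoundAt W 3 := by
  constructor
  · intro h W _ _ hO6 hsurj hev hsq hr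
    exact h W (not_hasCM_of_surj_three W hsurj) hO6 hsurj hev hsq hr
  · intro h W _ _ _ hO6 hsurj hev hsq hr
    exact h W hO6 hsurj hev hsq hr

/-- K2 BY NAME from its `¬ CM`-free form. [cite: Zywina2015, Prop. 1.14 and Prop. 1.16 (§1.9)] -/
theorem psRankOneUpperHalfAtThree_of_cmFree
    (h : ∀ (W : WeierstrassCurve ℚ) [W.IsElliptic] [W.IsGloballyMinimal],
      ClassO6 W 3 → Surj W 3 → Even (padicValInt 3 W.minimalDiscriminantInt) →
      W.minimalDiscriminantInt / 3 ^ padicValInt 3 W.minimalDiscriminantInt % 3 = 1 →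
      W.analyticRank = 1 → MissingUpperBoundAt W 3) :
    PSRankOneUpperHalfAtThree :=
  psRankOneUpperHalfAtThree_iff_cmFree.mpr h

/-- **X3 (the supercuspidal residual) without the `¬ CM` binder is the same statement.**
[cite: Zywina2015, Prop. 1.14 and Prop. 1.16 (§1.9)] -/
theorem wildSurjRankOneSupercuspidalAtThree_iff_cmFree :
    WildSurjRankOneSupercuspidalAtThree ↔
      ∀ (W : WeierstrassCurve ℚ) [W.IsElliptic] [W.IsGloballyMinimal],
        ClassO6 W 3 → Surj W 3 →
        ¬ (Even (padicValInt 3 W.minimalDiscriminantInt) ∧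
            W.minimalDiscriminantInt / 3 ^ padicValInt 3 W.minimalDiscriminantInt % 3 = 1) →
        W.analyticRank = 1 → BSDp W 3 := by
  constructor
  · intro h W _ _ hO6 hsurj hns hr
    exact h W (not_hasCM_of_surj_three W hsurj) hO6 hsurj hns hr
  · intro h W _ _ _ hO6 hsurj hns hr
    exact h W hO6 hsurj hns hr

/-- X3 BY NAME from its `¬ CM`-free form. [cite: Zywina2015, Prop. 1.14 and Prop. 1.16 (§1.9)] -/
theorem wildSurjRankOneSupercuspidalAtThree_of_cmFree
    (h : ∀ (W : WeierstrassCurve ℚ) [W.IsElliptic] [W.IsGloballyMinimal],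
      ClassO6 W 3 → Surj W 3 →
      ¬ (Even (padicValInt 3 W.minimalDiscriminantInt) ∧
          W.minimalDiscriminantInt / 3 ^ padicValInt 3 W.minimalDiscriminantInt % 3 = 1) →
      W.analyticRank = 1 → BSDp W 3) :
    WildSurjRankOneSupercuspidalAtThree :=
  wildSurjRankOneSupercuspidalAtThree_iff_cmFree.mpr h

end Summit.BirchSwinnertonDyer.BirchSwinnertonDyer.Theorems.PSIdleBinders
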